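import Literature.Topology.FourManifolds.SphereFamilySurgery
import Literature.Topology.FourManifolds.ClosedBallSmoothMaps
import Literature.Topology.FourManifolds.CerfGammaFourProofs
import HarnessLib

/-!
# Surgery along a framed family of spheres: reparametrising the spheres

Topic `Literature/Topology/FourManifolds` (proved API for `SphereFamilySurgery.lean`; fact seat
`provefact-Literature.Topology.FourManifolds.corkDecomposition`).  Milnor, *Lectures on the
h-cobordism theorem* (1965), Def. 3.11 (PDF p. 17): the surgered manifold `χ(V, φ)` only
depends on the embedding `φ : S^{λ-1} × OD^{n-λ} → V` through the identification
*"`φ(u, θv)` with `(θu, v)`"*; so replacing `φ` by `φ ∘ (A × id)` for a linear isometry `A` of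
`ℝ^λ` (restricted to `S^{λ-1}`, e.g. a hyperplane reflection) does not change `χ(V, φ)`: the
new piece `OD^λ × S^{n-λ-1}` is simply re-coordinatised by `(y, u) ↦ (A y, u)`.  This is the
invariance used to re-orient individual spheres of a framed family (Milnor 1965, Thm. 7.6:
*"the left-hand disks […], when suitably oriented, determine the given basis"*) without
changing the surgeries along it.  Everything here is proved:

* `Literature.Topology.FourManifolds.FramedSphereFamily.congr ν A` — the framed family `φᵢ ∘ (Aᵢ|_{Sᵏ} × id)` for linear isometries
  `Aᵢ` of `ℝᵏ⁺¹` (`Literature.Topology.FourManifolds.sphereCongr`, `ClosedBallSmoothMaps.lean`); its spheres are the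
  reparametrised spheres `sphere_congr`, with the same images, cores and complement
  (`range_sphere_congr`, `cores_congr`, `complement_congr`);
* `Literature.Topology.FourManifolds.ballTimesSphereCongr A` — the self-diffeomorphism `(i, y, u) ↦ (i, Aᵢ y, u)` of the new
  piece `ι × OD^{k+1} × Sˡ`;
* `Literature.Topology.FourManifolds.FramedSphereFamily.IsSurgery.congr` — **surgery is invariant under such
  reparametrisations**: if `P` is obtained from `X` by surgery along `ν` then also along
  `ν.congr A` (Milnor's identification transported along `ballTimesSphereCongr A`).

## References

* J. Milnor, *Lectures on the h-cobordism theorem*, Princeton (1965), Def. 3.11 (PDF p. 17),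
  Thm. 7.6 (PDF p. 50). [MilnorHCobordism1965]
-/

open scoped Manifold ContDiff Topology
open Set Function

noncomputable section

namespace Literature.Topology.FourManifolds

universe u

/-! ### Re-coordinatising the new piece -/

section NewPiece

variable {ι : Type u} {k l : ℕ}

/-- The map `(i, y, u) ↦ (i, Aᵢ y, u)` of `DiscreteIndex ι × (ℝᵏ⁺¹ × Sˡ)` for a family of
linear isometries `Aᵢ` of `ℝᵏ⁺¹`. [folklore] -/
def ballTimesSphereCongrMap (A : ι → (EuclideanSpace ℝ (Fin (k + 1)) ≃ₗᵢ[ℝ]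
      EuclideanSpace ℝ (Fin (k + 1))))
    (q : DiscreteIndex ι × (EuclideanSpace ℝ (Fin (k + 1)) ×
      (Metric.sphere (0 : EuclideanSpace ℝ (Fin (l + 1))) 1))) :
    DiscreteIndex ι × (EuclideanSpace ℝ (Fin (k + 1)) ×
      (Metric.sphere (0 : EuclideanSpace ℝ (Fin (l + 1))) 1)) :=
  (q.1, A (DiscreteIndex.mk.symm q.1) q.2.1, q.2.2)

/-- Unfolding lemma. [folklore] -/
@[simp] theorem ballTimesSphereCongrMap_apply
    (A : ι → (EuclideanSpace ℝ (Fin (k + 1)) ≃ₗᵢ[ℝ] EuclideanSpace ℝ (Fin (k + 1))))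
    (q : DiscreteIndex ι × (EuclideanSpace ℝ (Fin (k + 1)) ×
      (Metric.sphere (0 : EuclideanSpace ℝ (Fin (l + 1))) 1))) :
    ballTimesSphereCongrMap A q = (q.1, A (DiscreteIndex.mk.symm q.1) q.2.1, q.2.2) := rfl

/-- `(i, y, u) ↦ (i, Aᵢ⁻¹ y, u)` inverts `(i, y, u) ↦ (i, Aᵢ y, u)`. [folklore] -/
theorem ballTimesSphereCongrMap_symm_apply
    (A : ι → (EuclideanSpace ℝ (Fin (k + 1)) ≃ₗᵢ[ℝ] EuclideanSpace ℝ (Fin (k + 1))))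
    (q : DiscreteIndex ι × (EuclideanSpace ℝ (Fin (k + 1)) ×
      (Metric.sphere (0 : EuclideanSpace ℝ (Fin (l + 1))) 1))) :
    ballTimesSphereCongrMap (fun i => (A i).symm) (ballTimesSphereCongrMap A q) = q :=
  Prod.ext rfl (Prod.ext ((A (DiscreteIndex.mk.symm q.1)).symm_apply_apply q.2.1) rfl)

/-- The map `(i, y, u) ↦ (i, Aᵢ y, u)` is `C^∞`: near each point it is
`(i₀, A_{i₀} y, u)`, the index being locally constant. [folklore] -/
theorem contMDiff_ballTimesSphereCongrMap
    (A : ι → (EuclideanSpace ℝ (Fin (k + 1)) ≃ₗᵢ[ℝ] EuclideanSpace ℝ (Fin (k + 1)))) :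
    ContMDiff ((𝓡 0).prod ((𝓡 (k + 1)).prod (𝓡 l))) ((𝓡 0).prod ((𝓡 (k + 1)).prod (𝓡 l))) ∞
      (ballTimesSphereCongrMap (l := l) A) := by
  intro q₀
  have hloc : (fun q : DiscreteIndex ι × (EuclideanSpace ℝ (Fin (k + 1)) ×
      (Metric.sphere (0 : EuclideanSpace ℝ (Fin (l + 1))) 1)) =>
        (q.1, A (DiscreteIndex.mk.symm q₀.1) q.2.1, q.2.2)) =ᶠ[𝓝 q₀]
      ballTimesSphereCongrMap (l := l) A := by
    have hopen : IsOpen {q : DiscreteIndex ι × (EuclideanSpace ℝ (Fin (k + 1)) ×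
        (Metric.sphere (0 : EuclideanSpace ℝ (Fin (l + 1))) 1)) | q.1 = q₀.1} :=
      (isOpen_discrete {q₀.1}).preimage continuous_fst
    filter_upwards [hopen.mem_nhds rfl] with q hq
    rw [ballTimesSphereCongrMap_apply, show q.1 = q₀.1 from hq]
  refine ContMDiffAt.congr_of_eventuallyEq ?_ hloc.symm
  exact contMDiffAt_fst.prodMk
    ((((A (DiscreteIndex.mk.symm q₀.1)).toContinuousLinearEquiv.contDiff.contMDiff).contMDiffAt.comp
      q₀ (contMDiffAt_fst.comp q₀ contMDiffAt_snd)).prodMk (contMDiffAt_snd.comp q₀ contMDiffAt_snd))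

/-- `(i, y, u) ↦ (i, Aᵢ y, u)` preserves the new piece `{‖y‖ < 1}` (isometries preserve the
norm). [folklore] -/
theorem ballTimesSphereCongrMap_mem
    (A : ι → (EuclideanSpace ℝ (Fin (k + 1)) ≃ₗᵢ[ℝ] EuclideanSpace ℝ (Fin (k + 1))))
    {q : DiscreteIndex ι × (EuclideanSpace ℝ (Fin (k + 1)) ×
      (Metric.sphere (0 : EuclideanSpace ℝ (Fin (l + 1))) 1))}
    (hq : q ∈ ballTimesSphere ι k l) : ballTimesSphereCongrMap A q ∈ ballTimesSphere ι k l := by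
  simpa [ballTimesSphereCongrMap] using hq

/-- **Re-coordinatising the new piece**: the self-diffeomorphism `(i, y, u) ↦ (i, Aᵢ y, u)` of
`ι × OD^{k+1} × Sˡ` for a family of linear isometries `Aᵢ` of `ℝᵏ⁺¹`. [folklore] -/
def ballTimesSphereCongr
    (A : ι → (EuclideanSpace ℝ (Fin (k + 1)) ≃ₗᵢ[ℝ] EuclideanSpace ℝ (Fin (k + 1)))) :
    (↥(ballTimesSphere ι k l)) ≃ₘ⟮(𝓡 0).prod ((𝓡 (k + 1)).prod (𝓡 l)),
      (𝓡 0).prod ((𝓡 (k + 1)).prod (𝓡 l))⟯ ↥(ballTimesSphere ι k l) where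
  toFun b := ⟨ballTimesSphereCongrMap A b, ballTimesSphereCongrMap_mem A b.2⟩
  invFun b := ⟨ballTimesSphereCongrMap (fun i => (A i).symm) b,
    ballTimesSphereCongrMap_mem (fun i => (A i).symm) b.2⟩
  left_inv b := Subtype.ext (Prod.ext rfl
    (Prod.ext ((A (DiscreteIndex.mk.symm b.1.1)).symm_apply_apply b.1.2.1) rfl))
  right_inv b := Subtype.ext (Prod.ext rfl
    (Prod.ext ((A (DiscreteIndex.mk.symm b.1.1)).apply_symm_apply b.1.2.1) rfl))
  contMDiff_toFun := by
    rw [← ContMDiff.subtypeVal_comp_iff]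
    exact (contMDiff_ballTimesSphereCongrMap A).comp contMDiff_subtype_val
  contMDiff_invFun := by
    rw [← ContMDiff.subtypeVal_comp_iff]
    exact (contMDiff_ballTimesSphereCongrMap fun i => (A i).symm).comp contMDiff_subtype_val

/-- Unfolding lemma for `ballTimesSphereCongr`. [folklore] -/
@[simp] theorem coe_ballTimesSphereCongr_apply
    (A : ι → (EuclideanSpace ℝ (Fin (k + 1)) ≃ₗᵢ[ℝ] EuclideanSpace ℝ (Fin (k + 1))))
    (b : ↥(ballTimesSphere ι k l)) :
    ((ballTimesSphereCongr A b : ↥(ballTimesSphere ι k l)) :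
        DiscreteIndex ι × (EuclideanSpace ℝ (Fin (k + 1)) ×
          (Metric.sphere (0 : EuclideanSpace ℝ (Fin (l + 1))) 1))) =
      ballTimesSphereCongrMap A b := rfl

end NewPiece

/-! ### Reparametrising the spheres of a framed family -/

namespace FramedSphereFamily

section Congr

variable {EX HX : Type*} [NormedAddCommGroup EX] [NormedSpace ℝ EX] [TopologicalSpace HX]
  {IX : ModelWithCorners ℝ EX HX} {X : Type*} [TopologicalSpace X] [ChartedSpace HX X]
  {ι : Type u} {k m : ℕ} (ν : FramedSphereFamily IX X ι k m)

/-- **Reparametrising the spheres by linear isometries**: the framed family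
`(v, w) ↦ φᵢ (Aᵢ v, w)` for linear isometries `Aᵢ` of `ℝᵏ⁺¹` acting on `Sᵏ`
(`Literature.Topology.FourManifolds.sphereCongr`); e.g. `Aᵢ` a hyperplane reflection re-orients the `i`-th sphere
(Milnor 1965, Thm. 7.6: *"when suitably oriented"*). [cite: MilnorHCobordism1965, Def. 3.11 (PDF p. 17), Thm. 7.6 (PDF p. 50)] -/
def congr (A : ι → (EuclideanSpace ℝ (Fin (k + 1)) ≃ₗᵢ[ℝ] EuclideanSpace ℝ (Fin (k + 1)))) :
    FramedSphereFamily IX X ι k m where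
  toFun i := ν.toFun i ∘
    (sphereCongr (A i)).prodCongr (Diffeomorph.refl 𝓘(ℝ, EuclideanSpace ℝ (Fin m))
      (EuclideanSpace ℝ (Fin m)) ∞)
  isSmoothEmbedding i := (ν.isSmoothEmbedding i).comp_diffeomorph _
  isOpen_range i := by
    rw [(EquivLike.surjective _).range_comp]
    exact ν.isOpen_range i
  disjoint_range i j hij := by
    change Disjoint (range (ν.toFun i ∘ _)) (range (ν.toFun j ∘ _))
    rw [(EquivLike.surjective _).range_comp, (EquivLike.surjective _).range_comp]
    exact ν.disjoint_range hij

/-- Unfolding lemma for the reparametrised family. [folklore] -/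
@[simp] theorem congr_toFun_apply
    (A : ι → (EuclideanSpace ℝ (Fin (k + 1)) ≃ₗᵢ[ℝ] EuclideanSpace ℝ (Fin (k + 1))))
    (i : ι) (q : (Metric.sphere (0 : EuclideanSpace ℝ (Fin (k + 1))) 1) ×
      EuclideanSpace ℝ (Fin m)) :
    (ν.congr A).toFun i q = ν.toFun i (sphereCongr (A i) q.1, q.2) := rfl

/-- The spheres of the reparametrised family are the reparametrised spheres. [folklore] -/
theorem sphere_congr
    (A : ι → (EuclideanSpace ℝ (Fin (k + 1)) ≃ₗᵢ[ℝ] EuclideanSpace ℝ (Fin (k + 1)))) (i : ι) :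
    (ν.congr A).sphere i = ν.sphere i ∘ sphereCongr (A i) := rfl

/-- Reparametrising does not change the images of the spheres. [folklore] -/
theorem range_sphere_congr
    (A : ι → (EuclideanSpace ℝ (Fin (k + 1)) ≃ₗᵢ[ℝ] EuclideanSpace ℝ (Fin (k + 1)))) (i : ι) :
    range ((ν.congr A).sphere i) = range (ν.sphere i) := by
  rw [sphere_congr, (EquivLike.surjective _).range_comp]

/-- Reparametrising does not change the union of the core spheres. [folklore] -/
theorem cores_congr
    (A : ι → (EuclideanSpace ℝ (Fin (k + 1)) ≃ₗᵢ[ℝ] EuclideanSpace ℝ (Fin (k + 1)))) :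
    (ν.congr A).cores = ν.cores := by
  unfold cores
  exact iUnion_congr fun i => ν.range_sphere_congr A i

/-- Reparametrising does not change the complement of the core spheres. [folklore] -/
theorem complement_congr [T2Space X] [Finite ι]
    (A : ι → (EuclideanSpace ℝ (Fin (k + 1)) ≃ₗᵢ[ℝ] EuclideanSpace ℝ (Fin (k + 1)))) :
    (ν.congr A).complement = ν.complement := by
  apply TopologicalSpace.Opens.ext
  change ((ν.congr A).cores)ᶜ = ν.coresᶜ
  rw [cores_congr]

/-- The identification of the (equal) complements of the cores of `ν.congr A` and of `ν`, as a
diffeomorphism of open submanifolds of `X`. [folklore] -/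
def complementCongr [T2Space X] [Finite ι]
    (A : ι → (EuclideanSpace ℝ (Fin (k + 1)) ≃ₗᵢ[ℝ] EuclideanSpace ℝ (Fin (k + 1)))) :
    (↥(ν.congr A).complement) ≃ₘ⟮IX, IX⟯ ↥ν.complement where
  toFun a := ⟨a.1, (ν.complement_congr A).le a.2⟩
  invFun a := ⟨a.1, (ν.complement_congr A).ge a.2⟩
  left_inv _ := rfl
  right_inv _ := rfl
  contMDiff_toFun := contMDiff_inclusion (ν.complement_congr A).le
  contMDiff_invFun := contMDiff_inclusion (ν.complement_congr A).ge

/-- The identification of the complements is the identity on points of `X`. [folklore] -/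
@[simp] theorem coe_complementCongr_apply [T2Space X] [Finite ι]
    (A : ι → (EuclideanSpace ℝ (Fin (k + 1)) ≃ₗᵢ[ℝ] EuclideanSpace ℝ (Fin (k + 1))))
    (a : ↥(ν.congr A).complement) : ((ν.complementCongr A a : ↥ν.complement) : X) = a := rfl

end Congr

/-! ### Invariance of surgery -/

section Surgery

variable {EX HX : Type*} [NormedAddCommGroup EX] [NormedSpace ℝ EX] [TopologicalSpace HX]
  {IX : ModelWithCorners ℝ EX HX} {X : Type*} [TopologicalSpace X] [ChartedSpace HX X]
  [IsManifold IX ∞ X] [T2Space X] {ι : Type u} [Finite ι] {k l : ℕ}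
  (ν : FramedSphereFamily IX X ι k (l + 1))
  {EP HP : Type*} [NormedAddCommGroup EP] [NormedSpace ℝ EP] [TopologicalSpace HP]
  {IP : ModelWithCorners ℝ EP HP} {P : Type*} [TopologicalSpace P] [ChartedSpace HP P]

omit [IsManifold IX ∞ X] in
/-- Milnor's identification for the reparametrised family is Milnor's identification for the
original family transported along `(i, y, u) ↦ (i, Aᵢ y, u)` on the new piece:
`φᵢ(Aᵢ v, θu) ~' (i, θv, u)` iff `φᵢ(v', θu) ~ (i, θv', u)` with `v' = Aᵢ v`. [cite: MilnorHCobordism1965, Def. 3.11 (PDF p. 17)] -/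
theorem sphereFamilySurgeryRel_congr_iff
    (A : ι → (EuclideanSpace ℝ (Fin (k + 1)) ≃ₗᵢ[ℝ] EuclideanSpace ℝ (Fin (k + 1))))
    (a : ↥(ν.congr A).complement) (b : ↥(ballTimesSphere ι k l)) :
    sphereFamilySurgeryRel (ν.congr A) a b ↔
      sphereFamilySurgeryRel ν (ν.complementCongr A a) (ballTimesSphereCongr A b) := by
  constructor
  · rintro ⟨v, θ, hθ, hy, ha⟩
    refine ⟨sphereCongr (A (DiscreteIndex.mk.symm b.1.1)) v, θ, hθ, ?_, ?_⟩
    · simp only [coe_ballTimesSphereCongr_apply, ballTimesSphereCongrMap_apply, hy, map_smul,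
        coe_sphereCongr]
    · simpa using ha
  · rintro ⟨v, θ, hθ, hy, ha⟩
    refine ⟨(sphereCongr (A (DiscreteIndex.mk.symm b.1.1))).symm v, θ, hθ, ?_, ?_⟩
    · simp only [coe_ballTimesSphereCongr_apply, ballTimesSphereCongrMap_apply] at hy
      apply (A (DiscreteIndex.mk.symm b.1.1)).injective
      rw [hy, map_smul, sphereCongr_symm, coe_sphereCongr]
      simp
    · simp only [coe_complementCongr_apply, coe_ballTimesSphereCongr_apply,
        ballTimesSphereCongrMap_apply] at ha
      simp only [congr_toFun_apply, Diffeomorph.apply_symm_apply]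
      exact ha

/-- **Surgery along a framed family is invariant under reparametrising the spheres by linear
isometries** (Milnor 1965, Def. 3.11: `χ(V, φ)` only sees the identification
*"`φ(u, θv)` with `(θu, v)`"*, which `(y, u) ↦ (A y, u)` transports): if `P` is obtained from
`X` by surgery along `ν`, then also along `ν.congr A`. [cite: MilnorHCobordism1965, Def. 3.11 (PDF p. 17)] -/
theorem IsSurgery.congr
    (A : ι → (EuclideanSpace ℝ (Fin (k + 1)) ≃ₗᵢ[ℝ] EuclideanSpace ℝ (Fin (k + 1))))
    (h : ν.IsSurgery IP P) : (ν.congr A).IsSurgery IP P := by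
  obtain ⟨jA, jB, hA, hAo, hB, hBo, hU, hR⟩ := h
  refine ⟨jA ∘ ν.complementCongr A, jB ∘ ballTimesSphereCongr A, hA.comp_diffeomorph _, ?_,
    hB.comp_diffeomorph _, ?_, ?_, fun a b => ?_⟩
  · rw [(EquivLike.surjective _).range_comp]
    exact hAo
  · rw [(EquivLike.surjective _).range_comp]
    exact hBo
  · rw [(EquivLike.surjective _).range_comp, (EquivLike.surjective _).range_comp]
    exact hU
  · rw [Function.comp_apply, Function.comp_apply, hR, sphereFamilySurgeryRel_congr_iff]

end Surgery

end FramedSphereFamily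

end Literature.Topology.FourManifolds

end
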